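import Mathlib
import Literature.Combinatorics.Additive.ErdosHeilbronn
import Literature.NumberTheory.Sieve.PrimeGapLimitPoints
import HarnessLib

/-!
# Prime-gap limit points, the torus cap (cell parity-ideate, p4 ROUND-12) — part 1/8 (`BrauerFree` … `lowPiece_subset_D3`)

Source: `HOME/parity-ideate-p4/round12/Sketch16.lean` (sha16 e5770481db81479a, 7 278 lines, farm rc 0 / 0 sorry /
axioms std-3; namespace `ParityIdeateP4R8`), cut by parity-ideate-lit g32 (`ports/toruscap/build_toruscap.py`) to the
dependency cone (143 declarations) of the eight headline declarations `torusCap_iff`, `torusCapBrauer_iff`,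
`torusCap_half`, `cb1_holds`, `conjHalfStrict_holds`, `NearAP.delannoyNonVanishing_holds`, `capGivesCoverage`,
`residueCoverage_half_of_literature`, in a chain of 8 files of ≤ 400 lines (Theorems-side lint); statements byte-identical
to the source except: `NearAP.P0/P1/P2` are `abbrev` (source: `def` + three `Decidable` instances, dropped per the typing
lint), examples and `decide` rungs outside the cone dropped, namespace `ParityIdeateP4R8` ↦ `Summit.Parity.GeneralizedHardyLittlewood.Theorems.PrimeGapTorusCap`.
Non-Mathlib inputs: `Literature.Combinatorics.Additive.ErdosHeilbronn` (combinatorial Nullstellensatz),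
`Literature.NumberTheory.Sieve.PrimeGapLimitPoints` (`primeGapLimitSet`, `HasPointProperty`, the NAMED fact
`Merikoski2020_theorem1`, used hypothesis-style, never asserted).  No `sorry`, no new axioms, no `instance`, no notation.
Cell-original mathematics (FRONTIER formalisation; nothing here bears on the parity problem beyond the typed statements):
CONJECTURE C of the cell = every measurable `perℤ`-periodic four-point-free `U ⊆ ℝ` has `μ(U ∩ [0,per)) ≤ per/2`,
sharp (mid arc); pay-off: residues of the prime-gap limit-point set `𝓛` modulo `λ` cover ≥ half of `[0, λ)` for every
`λ > 0`, given Merikoski's four-point theorem.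
-/

namespace Summit.Parity.GeneralizedHardyLittlewood.Theorems.PrimeGapTorusCap
open MeasureTheory Set
/-! ## §A  Brauer-freeness, the 3-AP-difference set, LEMMA S -/

/-- no 3-term AP `x, x+d, x+2d` in `S` whose common difference `d` also lies in `S` (verbatim Sketch7) -/
def BrauerFree (S : Set ℝ) : Prop :=
  ∀ d x : ℝ, d ∈ S → x ∈ S → x + d ∈ S → x + 2 * d ∈ S → False

/-- the set of common differences of 3-term APs contained in `U` -/
def D3 (U : Set ℝ) : Set ℝ := {d : ℝ | ∃ x : ℝ, x ∈ U ∧ x + d ∈ U ∧ x + 2 * d ∈ U}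

/-- (cell parity-ideate p4, Sketch16 — helper; statement verbatim) -/
theorem brauerFree_iff_forall_not_mem_D3 (U : Set ℝ) : BrauerFree U ↔ ∀ d ∈ U, d ∉ D3 U := by
  constructor
  · rintro h d hd ⟨x, hx, hxd, hx2d⟩
    exact h d x hd hx hxd hx2d
  · intro h d x hd hx hxd hx2d
    exact h d hd ⟨x, hx, hxd, hx2d⟩

/-- (cell parity-ideate p4, Sketch16 — helper; statement verbatim) -/
theorem disjoint_D3_of_brauerFree {U : Set ℝ} (h : BrauerFree U) : Disjoint (D3 U) U := by
  rw [Set.disjoint_left]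
  intro d hd3 hdU
  exact (brauerFree_iff_forall_not_mem_D3 U).1 h d hdU hd3

/-- 1-periodicity in the form used by p4's `TorusCap` (with `per = 1`). -/
def Periodic1 (U : Set ℝ) : Prop := ∀ t ∈ U, ∀ n : ℤ, t + n ∈ U

/-! ## §B  δ-shells -/

/-- Conjecture C_B at period 1: every Brauer-free 1-periodic measurable set has measure `≤ 1/2` per period. -/
def CB1 : Prop :=
  ∀ U : Set ℝ, MeasurableSet U → Periodic1 U → BrauerFree U →
    volume (U ∩ Set.Ico (0 : ℝ) 1) ≤ ENNReal.ofReal (1 / 2)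

section deltaWindows
open Filter Topology
end deltaWindows
end Summit.Parity.GeneralizedHardyLittlewood.Theorems.PrimeGapTorusCap
/-! ## §AI (ROUND-9, instrument X) — the NEAR-AP (block) form of (Δ½): for S ⊂ ℤ_N and the block set U_S = ⋃_{s∈S} [s/N,(s+1)/N),
μ(D₃ U_S) = (|D₃⁺S| + |D₃⁻S|)/(2N) (desk lemma, ROUND-9 §1.5(f)), so (Δ½) restricted to block sets is the purely
combinatorial statement `ConjHalfZ` below. -/

namespace Summit.Parity.GeneralizedHardyLittlewood.Theorems.PrimeGapTorusCap.NearAP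
variable {N : ℕ}
/-- `P0 S j`: a genuine 3-AP `s, s+j, s+2j` in `S` (degenerate `j = 0` allowed). -/
abbrev P0 (S : Finset (ZMod N)) (j : ZMod N) : Prop := ∃ s ∈ S, s + j ∈ S ∧ s + 2 * j ∈ S

/-- `P1 S j`: a near-AP with steps `(j, j+1)`: `s, s+j, s+2j+1 ∈ S`. -/
abbrev P1 (S : Finset (ZMod N)) (j : ZMod N) : Prop := ∃ s ∈ S, s + j ∈ S ∧ s + 2 * j + 1 ∈ S

/-- `P2 S j`: a near-AP with steps `(j+1, j)`: `s, s+j+1, s+2j+1 ∈ S`. -/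
abbrev P2 (S : Finset (ZMod N)) (j : ZMod N) : Prop := ∃ s ∈ S, s + j + 1 ∈ S ∧ s + 2 * j + 1 ∈ S

variable [NeZero N]
/-- `|D₃⁺ S|` = number of `j` such that `d = (j+θ)/N`, `0 < θ < 1/2`, lies in `D₃ U_S`. -/
def d3plusCard (S : Finset (ZMod N)) : ℕ := (Finset.univ.filter fun j => P0 S j ∨ P1 S j ∨ P2 S j).card

/-- `|D₃⁻ S|` = number of `j` such that `d = (j+θ)/N`, `1/2 < θ < 1`, lies in `D₃ U_S`. -/
def d3minusCard (S : Finset (ZMod N)) : ℕ := (Finset.univ.filter fun j => P1 S j ∨ P2 S j ∨ P0 S (j + 1)).card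

end Summit.Parity.GeneralizedHardyLittlewood.Theorems.PrimeGapTorusCap.NearAP
namespace Summit.Parity.GeneralizedHardyLittlewood.Theorems.PrimeGapTorusCap.NearAP
end Summit.Parity.GeneralizedHardyLittlewood.Theorems.PrimeGapTorusCap.NearAP
namespace Summit.Parity.GeneralizedHardyLittlewood.Theorems.PrimeGapTorusCap.NearAP
variable {N : ℕ} [NeZero N]
end Summit.Parity.GeneralizedHardyLittlewood.Theorems.PrimeGapTorusCap.NearAP
namespace Summit.Parity.GeneralizedHardyLittlewood.Theorems.PrimeGapTorusCap.NearAP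
end Summit.Parity.GeneralizedHardyLittlewood.Theorems.PrimeGapTorusCap.NearAP
namespace Summit.Parity.GeneralizedHardyLittlewood.Theorems.PrimeGapTorusCap
open MeasureTheory Set Filter Topology NearAP
/-! ### AK.1 grid cells and dense cells -/

/-- the grid cell `C_{N,a} = [a/N, (a+1)/N)`. -/
def cell (N : ℕ) (a : ℤ) : Set ℝ := Set.Ico ((a : ℝ) / N) (((a : ℝ) + 1) / N)

/-- (cell parity-ideate p4, Sketch16 — helper; statement verbatim) -/
theorem volume_cell {N : ℕ} (hN : 0 < N) (a : ℤ) : volume (cell N a) = ENNReal.ofReal (1 / N) := by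
  have hN' : (0 : ℝ) < N := Nat.cast_pos.2 hN
  rw [cell, Real.volume_Ico]
  congr 1
  rw [div_sub_div_same]
  congr 1
  ring

/-- (cell parity-ideate p4, Sketch16 — helper; statement verbatim) -/
theorem mem_cell_iff {N : ℕ} (hN : 0 < N) {a : ℤ} {x : ℝ} :
    x ∈ cell N a ↔ (a : ℝ) ≤ N * x ∧ (N : ℝ) * x < a + 1 := by
  have hN' : (0 : ℝ) < N := Nat.cast_pos.2 hN
  rw [cell, Set.mem_Ico, div_le_iff₀ hN', lt_div_iff₀ hN']
  constructor
  · rintro ⟨h1, h2⟩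
    exact ⟨by linarith [mul_comm x (N : ℝ)], by linarith [mul_comm x (N : ℝ)]⟩
  · rintro ⟨h1, h2⟩
    exact ⟨by linarith [mul_comm x (N : ℝ)], by linarith [mul_comm x (N : ℝ)]⟩

/-- (cell parity-ideate p4, Sketch16 — helper; statement verbatim) -/
theorem floor_mem_cell {N : ℕ} (hN : 0 < N) (x : ℝ) : x ∈ cell N ⌊(N : ℝ) * x⌋ := by
  rw [mem_cell_iff hN]
  exact ⟨Int.floor_le _, Int.lt_floor_add_one _⟩

/-- periodicity: the cell `C_{N,a+Nm} = C_{N,a} + m` carries the same mass of a 1-periodic set. -/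
theorem volume_inter_cell_add_mul {U : Set ℝ} (hP : Periodic1 U) {N : ℕ} (hN : 0 < N) (a m : ℤ) :
    volume (U ∩ cell N (a + N * m)) = volume (U ∩ cell N a) := by
  have hN' : (0 : ℝ) < N := Nat.cast_pos.2 hN
  have key : (fun x : ℝ => x + m) ⁻¹' (U ∩ cell N (a + N * m)) = U ∩ cell N a := by
    ext x
    simp only [Set.mem_preimage, Set.mem_inter_iff, mem_cell_iff hN]
    push_cast
    constructor
    · rintro ⟨h1, h2, h3⟩
      refine ⟨?_, by linarith, by linarith⟩
      have := hP (x + m) h1 (-m)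
      simpa using this
    · rintro ⟨h1, h2, h3⟩
      exact ⟨hP x h1 m, by linarith, by linarith⟩
  rw [← key, measure_preimage_add_right]

/-- the cell `C_{N,a}` is `η`-DENSE for `U`: `μ(U ∩ C_{N,a}) > (1-η)/N`. -/
def CellDense (U : Set ℝ) (N : ℕ) (η : ℝ) (a : ℤ) : Prop :=
  ENNReal.ofReal ((1 - η) / N) < volume (U ∩ cell N a)

/-- (cell parity-ideate p4, Sketch16 — helper; statement verbatim) -/
theorem cellDense_add_mul {U : Set ℝ} (hP : Periodic1 U) {N : ℕ} (hN : 0 < N) (η : ℝ) (a m : ℤ) :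
    CellDense U N η (a + N * m) ↔ CellDense U N η a := by
  unfold CellDense
  rw [volume_inter_cell_add_mul hP hN]

/-- density of a cell depends only on the residue of its index mod `N`. -/
theorem cellDense_iff_of_cast_eq {U : Set ℝ} (hP : Periodic1 U) {N : ℕ} (hN : 0 < N) (η : ℝ) {z : ℤ}
    {t : ZMod N} (h : (z : ZMod N) = t) : CellDense U N η z ↔ CellDense U N η (t.val : ℤ) := by
  haveI : NeZero N := ⟨hN.ne'⟩
  have h' : ((t.val : ℤ) : ZMod N) = (z : ZMod N) := by
    rw [h, Int.cast_natCast, ZMod.natCast_zmod_val]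
  obtain ⟨m, hm⟩ := (ZMod.intCast_eq_intCast_iff_dvd_sub _ _ _).1 h'
  have hz : z = (t.val : ℤ) + N * m := by linarith
  rw [hz, cellDense_add_mul hP hN]

/-! ### AK.2 three dense cells in near-AP position force a progression (union bound with margins) -/

/-- **the margin lemma.**  If the cells `a, b, c` are `η`-dense and for every `φ ∈ [φ₀, φ₁)` the point `x = (a+φ)/N`
has `x + e/N ∈ C_b` and `x + 2e/N ∈ C_c`, where `φ₁ - φ₀ ≥ 3η`, then `e/N ∈ D₃ U`. -/
theorem exists_ap_of_cellDense {U : Set ℝ} (hU : MeasurableSet U) {N : ℕ} (hN : 0 < N) {η : ℝ}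
    (hη0 : 0 < η) {a b c : ℤ}
    (ha : CellDense U N η a) (hb : CellDense U N η b) (hc : CellDense U N η c)
    {e φ₀ φ₁ : ℝ} (h0 : 0 ≤ φ₀) (h1 : φ₁ ≤ 1) (hgap : 3 * η ≤ φ₁ - φ₀)
    (hB : ∀ φ : ℝ, φ₀ ≤ φ → φ < φ₁ → (b : ℝ) ≤ a + φ + e ∧ (a : ℝ) + φ + e < b + 1)
    (hC : ∀ φ : ℝ, φ₀ ≤ φ → φ < φ₁ → (c : ℝ) ≤ a + φ + 2 * e ∧ (a : ℝ) + φ + 2 * e < c + 1) :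
    e / N ∈ D3 U := by
  have hN' : (0 : ℝ) < N := Nat.cast_pos.2 hN
  by_contra hno
  set I : Set ℝ := Set.Ico (((a : ℝ) + φ₀) / N) (((a : ℝ) + φ₁) / N) with hI
  have hcov : I ⊆ (cell N a \ U) ∪ (fun x : ℝ => x + e / N) ⁻¹' (cell N b \ U) ∪
      (fun x : ℝ => x + 2 * (e / N)) ⁻¹' (cell N c \ U) := by
    intro x hx
    rw [hI, Set.mem_Ico, div_le_iff₀ hN', lt_div_iff₀ hN'] at hx
    have hφ0 : φ₀ ≤ x * N - a := by linarith
    have hφ1 : x * N - a < φ₁ := by linarith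
    have hxa : x ∈ cell N a := by
      rw [mem_cell_iff hN]
      exact ⟨by linarith [mul_comm x (N : ℝ)], by linarith [mul_comm x (N : ℝ)]⟩
    have hxb : x + e / N ∈ cell N b := by
      obtain ⟨hb1, hb2⟩ := hB (x * N - a) hφ0 hφ1
      rw [mem_cell_iff hN]
      have ee : (N : ℝ) * (x + e / N) = (a : ℝ) + (x * N - a) + e := by
        field_simp
        ring
      rw [ee]
      exact ⟨hb1, hb2⟩
    have hxc : x + 2 * (e / N) ∈ cell N c := by
      obtain ⟨hc1, hc2⟩ := hC (x * N - a) hφ0 hφ1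
      rw [mem_cell_iff hN]
      have ee : (N : ℝ) * (x + 2 * (e / N)) = (a : ℝ) + (x * N - a) + 2 * e := by
        field_simp
        ring
      rw [ee]
      exact ⟨hc1, hc2⟩
    by_cases hu1 : x ∈ U
    · by_cases hu2 : x + e / N ∈ U
      · by_cases hu3 : x + 2 * (e / N) ∈ U
        · exact absurd ⟨x, hu1, hu2, hu3⟩ hno
        · exact Or.inr ⟨hxc, hu3⟩
      · exact Or.inl (Or.inr ⟨hxb, hu2⟩)
    · exact Or.inl (Or.inl ⟨hxa, hu1⟩)
  have hsmall : ∀ z : ℤ, CellDense U N η z → volume (cell N z \ U) < ENNReal.ofReal (η / N) := by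
    intro z hz
    unfold CellDense at hz
    have hsum : volume (cell N z ∩ U) + volume (cell N z \ U) = ENNReal.ofReal (1 / N) := by
      rw [measure_inter_add_sdiff _ hU, volume_cell hN]
    rw [Set.inter_comm] at hz
    by_contra hge
    push Not at hge
    have hlt : ENNReal.ofReal ((1 - η) / N) + ENNReal.ofReal (η / N) <
        volume (cell N z ∩ U) + volume (cell N z \ U) :=
      ENNReal.add_lt_add_of_lt_of_le ENNReal.ofReal_ne_top hz hge
    rw [hsum, ← ENNReal.ofReal_add (div_nonneg (by linarith) hN'.le) (div_nonneg hη0.le hN'.le)] at hlt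
    have ee : (1 - η) / N + η / N = 1 / (N : ℝ) := by ring
    rw [ee] at hlt
    exact lt_irrefl _ hlt
  have hIvol : volume I = ENNReal.ofReal ((φ₁ - φ₀) / N) := by
    rw [hI, Real.volume_Ico]
    congr 1
    rw [div_sub_div_same]
    congr 1
    ring
  have hle : volume I ≤ volume (cell N a \ U) + volume (cell N b \ U) + volume (cell N c \ U) := by
    calc volume I ≤ volume ((cell N a \ U) ∪ (fun x : ℝ => x + e / N) ⁻¹' (cell N b \ U) ∪
          (fun x : ℝ => x + 2 * (e / N)) ⁻¹' (cell N c \ U)) := measure_mono hcov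
      _ ≤ volume ((cell N a \ U) ∪ (fun x : ℝ => x + e / N) ⁻¹' (cell N b \ U)) +
          volume ((fun x : ℝ => x + 2 * (e / N)) ⁻¹' (cell N c \ U)) := measure_union_le _ _
      _ ≤ volume (cell N a \ U) + volume ((fun x : ℝ => x + e / N) ⁻¹' (cell N b \ U)) +
          volume ((fun x : ℝ => x + 2 * (e / N)) ⁻¹' (cell N c \ U)) := by
          gcongr
          exact measure_union_le _ _
      _ = volume (cell N a \ U) + volume (cell N b \ U) + volume (cell N c \ U) := by
          rw [measure_preimage_add_right, measure_preimage_add_right]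
  have hlt : volume I < ENNReal.ofReal (η / N) + ENNReal.ofReal (η / N) + ENNReal.ofReal (η / N) :=
    hle.trans_lt (ENNReal.add_lt_add (ENNReal.add_lt_add (hsmall a ha) (hsmall b hb)) (hsmall c hc))
  have hηN : 0 ≤ η / N := div_nonneg hη0.le hN'.le
  have h3sum : ENNReal.ofReal (η / N) + ENNReal.ofReal (η / N) + ENNReal.ofReal (η / N) =
      ENNReal.ofReal (3 * η / N) := by
    rw [← ENNReal.ofReal_add hηN hηN, ← ENNReal.ofReal_add (add_nonneg hηN hηN) hηN]
    congr 1
    ring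
  rw [hIvol, h3sum, ENNReal.ofReal_lt_ofReal_iff (by positivity), div_lt_div_iff_of_pos_right hN'] at hlt
  linarith

/-- pattern `P0`: dense cells `a, a+b, a+2b` put every `(b+θ)/N`, `|θ| ≤ (1-3η)/2`, into `D₃U`. -/
theorem D3_of_P0cells {U : Set ℝ} (hU : MeasurableSet U) {N : ℕ} (hN : 0 < N) {η : ℝ}
    (hη0 : 0 < η) {a b : ℤ}
    (ha : CellDense U N η a) (hb : CellDense U N η (a + b)) (hc : CellDense U N η (a + 2 * b))
    {θ : ℝ} (hθ : |θ| ≤ (1 - 3 * η) / 2) : ((b : ℝ) + θ) / N ∈ D3 U := by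
  rw [abs_le] at hθ
  rcases le_or_gt 0 θ with h | h
  · refine exists_ap_of_cellDense hU hN hη0 ha hb hc (φ₀ := 0) (φ₁ := 1 - 2 * θ)
      le_rfl (by linarith) (by linarith) ?_ ?_
    · intro φ hφ0 hφ1
      push_cast
      exact ⟨by linarith, by linarith⟩
    · intro φ hφ0 hφ1
      push_cast
      exact ⟨by linarith, by linarith⟩
  · refine exists_ap_of_cellDense hU hN hη0 ha hb hc (φ₀ := -2 * θ) (φ₁ := 1)
      (by linarith) le_rfl (by linarith) ?_ ?_
    · intro φ hφ0 hφ1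
      push_cast
      exact ⟨by linarith, by linarith⟩
    · intro φ hφ0 hφ1
      push_cast
      exact ⟨by linarith, by linarith⟩

/-- pattern `P1`: dense cells `a, a+b, a+2b+1` put every `(b+θ)/N`, `3η ≤ θ ≤ 1-3η`, into `D₃U`. -/
theorem D3_of_P1cells {U : Set ℝ} (hU : MeasurableSet U) {N : ℕ} (hN : 0 < N) {η : ℝ}
    (hη0 : 0 < η) {a b : ℤ}
    (ha : CellDense U N η a) (hb : CellDense U N η (a + b)) (hc : CellDense U N η (a + 2 * b + 1))
    {θ : ℝ} (hθ0 : 3 * η ≤ θ) (hθ1 : θ ≤ 1 - 3 * η) : ((b : ℝ) + θ) / N ∈ D3 U := by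
  rcases le_or_gt θ (1 / 2) with h | h
  · refine exists_ap_of_cellDense hU hN hη0 ha hb hc (φ₀ := 1 - 2 * θ) (φ₁ := 1 - θ)
      (by linarith) (by linarith) (by linarith) ?_ ?_
    · intro φ hφ0 hφ1
      push_cast
      exact ⟨by linarith, by linarith⟩
    · intro φ hφ0 hφ1
      push_cast
      exact ⟨by linarith, by linarith⟩
  · refine exists_ap_of_cellDense hU hN hη0 ha hb hc (φ₀ := 0) (φ₁ := 1 - θ)
      le_rfl (by linarith) (by linarith) ?_ ?_
    · intro φ hφ0 hφ1
      push_cast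
      exact ⟨by linarith, by linarith⟩
    · intro φ hφ0 hφ1
      push_cast
      exact ⟨by linarith, by linarith⟩

/-- pattern `P2`: dense cells `a, a+b+1, a+2b+1` put every `(b+θ)/N`, `3η ≤ θ ≤ 1-3η`, into `D₃U`. -/
theorem D3_of_P2cells {U : Set ℝ} (hU : MeasurableSet U) {N : ℕ} (hN : 0 < N) {η : ℝ}
    (hη0 : 0 < η) {a b : ℤ}
    (ha : CellDense U N η a) (hb : CellDense U N η (a + b + 1)) (hc : CellDense U N η (a + 2 * b + 1))
    {θ : ℝ} (hθ0 : 3 * η ≤ θ) (hθ1 : θ ≤ 1 - 3 * η) : ((b : ℝ) + θ) / N ∈ D3 U := by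
  rcases le_or_gt θ (1 / 2) with h | h
  · refine exists_ap_of_cellDense hU hN hη0 ha hb hc (φ₀ := 1 - θ) (φ₁ := 1)
      (by linarith) le_rfl (by linarith) ?_ ?_
    · intro φ hφ0 hφ1
      push_cast
      exact ⟨by linarith, by linarith⟩
    · intro φ hφ0 hφ1
      push_cast
      exact ⟨by linarith, by linarith⟩
  · refine exists_ap_of_cellDense hU hN hη0 ha hb hc (φ₀ := 1 - θ) (φ₁ := 2 - 2 * θ)
      (by linarith) (by linarith) (by linarith) ?_ ?_
    · intro φ hφ0 hφ1
      push_cast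
      exact ⟨by linarith, by linarith⟩
    · intro φ hφ0 hφ1
      push_cast
      exact ⟨by linarith, by linarith⟩

/-! ### AK.3 from near-AP patterns of dense residues to intervals of differences -/

/-- (cell parity-ideate p4, Sketch16 — helper; statement verbatim) -/
theorem Ioo_disjoint_of_le {p q r s : ℝ} (h : q ≤ r) : Disjoint (Set.Ioo p q) (Set.Ioo r s) :=
  Set.disjoint_left.2 fun x hx hx' => lt_irrefl x ((hx.2.trans_le h).trans hx'.1)

section Residues
variable {N : ℕ} [NeZero N]
/-- casting helper: `(s.val + c : ℤ) ↦ s + c` in `ℤ_N`. -/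
theorem cast_val_add (s : ZMod N) (c : ℤ) : (((s.val : ℤ) + c : ℤ) : ZMod N) = s + c := by
  push_cast
  rw [ZMod.natCast_zmod_val]

/-- the lower piece of the `j`-th difference cell and the upper piece -/
def lowPiece (N : ℕ) (η : ℝ) (j : ZMod N) : Set ℝ :=
  Set.Ioo (((j.val : ℝ) + 3 * η) / N) (((j.val : ℝ) + 1 / 2 - 2 * η) / N)

/-- (cell parity-ideate p4, Sketch16 — helper; statement verbatim) -/
def upPiece (N : ℕ) (η : ℝ) (j : ZMod N) : Set ℝ :=
  Set.Ioo (((j.val : ℝ) + 1 / 2 + 2 * η) / N) (((j.val : ℝ) + 1 - 3 * η) / N)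

/-- (cell parity-ideate p4, Sketch16 — helper; statement verbatim) -/
theorem lowPiece_subset_D3 {U : Set ℝ} (hU : MeasurableSet U) (hP : Periodic1 U) {η : ℝ}
    (hη0 : 0 < η) {S : Finset (ZMod N)}
    (hS : ∀ s ∈ S, CellDense U N η (s.val : ℤ)) {j : ZMod N} (hj : P0 S j ∨ P1 S j ∨ P2 S j) :
    lowPiece N η j ⊆ D3 U := by
  have hN : 0 < N := Nat.pos_of_ne_zero (NeZero.ne N)
  have hN' : (0 : ℝ) < N := Nat.cast_pos.2 hN
  intro d hd
  simp only [lowPiece, Set.mem_Ioo, div_lt_iff₀ hN', lt_div_iff₀ hN'] at hd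
  obtain ⟨hd1, hd2⟩ := hd
  -- d = (j.val + θ)/N with θ := d N - j.val ∈ (3η, 1/2 - 2η)
  have hdeq : d = (((j.val : ℤ) : ℝ) + (d * N - j.val)) / N := by
    push_cast
    field_simp
    ring
  rw [hdeq]
  have dens : ∀ (s : ZMod N) (c z : ℤ), z = (s.val : ℤ) + c → s + (c : ZMod N) ∈ S → CellDense U N η z := by
    rintro s c z rfl hsc
    exact (cellDense_iff_of_cast_eq hP hN η (cast_val_add s c)).2 (hS _ hsc)
  have hv : ((j.val : ℕ) : ZMod N) = j := ZMod.natCast_zmod_val j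
  rcases hj with ⟨s, hs, h1, h2⟩ | ⟨s, hs, h1, h2⟩ | ⟨s, hs, h1, h2⟩
  · exact D3_of_P0cells hU hN hη0 (hS s hs)
      (dens s (j.val : ℤ) _ (by ring) (by push_cast; rw [hv]; exact h1))
      (dens s (2 * (j.val : ℤ)) _ (by ring) (by push_cast; rw [hv]; exact h2))
      (abs_le.2 ⟨by linarith, by linarith⟩)
  · exact D3_of_P1cells hU hN hη0 (hS s hs)
      (dens s (j.val : ℤ) _ (by ring) (by push_cast; rw [hv]; exact h1))
      (dens s (2 * (j.val : ℤ) + 1) _ (by ring) (by push_cast; rw [hv, ← add_assoc]; exact h2))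
      (by linarith) (by linarith)
  · exact D3_of_P2cells hU hN hη0 (hS s hs)
      (dens s ((j.val : ℤ) + 1) _ (by ring) (by push_cast; rw [hv, ← add_assoc]; exact h1))
      (dens s (2 * (j.val : ℤ) + 1) _ (by ring) (by push_cast; rw [hv, ← add_assoc]; exact h2))
      (by linarith) (by linarith)

end Residues
end Summit.Parity.GeneralizedHardyLittlewood.Theorems.PrimeGapTorusCap
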